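import Literature.MathematicalPhysics.QuantumFieldTheory.OSTimeTubeCoordinates
import HarnessLib

/-!
# Spatial isometries act trivially on an OS time continuation and on its boundary value

Support file (everything proved; no definitions, no named facts) for (B)
`Literature.MathematicalPhysics.QuantumFieldTheory.OS1973_lorentzInvariant_of_timeContinuation`
(`OSTimeContinuation`; Osterwalder–Schrader I (1973), §4.2: Lorentz invariance of the Wightman
distributions from the Euclidean covariance E1). This file treats the *spatial* part `1 ⊕ R`,
`R ∈ O(d)`, of the orthochronous Lorentz group, for a function `𝔚` which is only known on the
**time tube** (continuous there, holomorphic in the times, with Euclidean restriction `𝔖ₙ` on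
time-ordered test functions and a time-ray boundary value `T`) — the setting of OS II, Thm. 4.3,
as opposed to the full forward tube of the tree's `OSLorentzInvariance`:

* `lorentzActC_spatialRotation_tsCfg` — `(1 ⊕ R)_ℂ` acts on the time tube by rotating the real
  spatial parts, `(1 ⊕ R)_ℂ (w, y) = (w, R y)`; in particular it preserves the time tube;
* `apply_lorentzActC_spatialRotation_eq` — **E1 makes `𝔚` invariant**: `𝔚 ((1 ⊕ R)_ℂ z) = 𝔚 z`
  on the time tube. At Euclidean points this is E1 read through the Euclidean formula
  (`∫ 𝔚(ι R̂x) F = ∫ 𝔚(ιy) F(R̂⁻¹y) = 𝔖ₙ(F ∘ R̂⁻¹) = 𝔖ₙ(F)`, rotation invariance of Lebesgue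
  measure, `eqOn_timeOrderedRegion_of_integral_eq`), and the identity theorem for time-holomorphic
  functions from Euclidean points (`eqOn_timeTube_of_euclidean`, `OSTimeTubeCoordinates`)
  propagates it to the time tube;
* `HasTimeRayBoundaryValue.apply_eq_of_timeTube_invariant` — invariance on the time tube under a
  Lorentz transformation fixing `e₀` passes to the time-ray boundary value, `T(F ∘ Λ⁻¹) = T(F)`
  (change of variables in the approximating integrals along the standard temporal direction,
  which `Λ` fixes);
* `HasTimeRayBoundaryValue.apply_eq_of_spatialRotation` — the conclusion for `Λ = 1 ⊕ R`.

The boosts, which do not preserve the time tube, are treated infinitesimally in the sequel files.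

## References

* K. Osterwalder, R. Schrader, *Axioms for Euclidean Green's functions*, Comm. Math. Phys. 31
  (1973) 83–112, §4.2. [OsterwalderSchraderCMP1973]
* K. Osterwalder, R. Schrader, *Axioms for Euclidean Green's functions II*, Comm. Math. Phys. 42
  (1975) 281–305, §IV.2 p. 288 ("The remaining Wightman axioms can be established as in Sections
  4.2–4.5 of OS I"). [OsterwalderSchraderCMP1975]
-/

noncomputable section

open Filter Complex Set MeasureTheory
open scoped Topology SchwartzMap
open Literature.MathematicalPhysics.QuantumLattice

namespace Literature.MathematicalPhysics.QuantumFieldTheory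

variable {d n : ℕ}

/-! ### Spatial isometries in time–space coordinates -/

/-- **A spatial isometry acts on `tsCfg w y` by rotating the spatial parts**:
`(1 ⊕ R)_ℂ (w_k, y_k) = (w_k, R y_k)`. [folklore] -/
theorem lorentzActC_spatialRotation_tsCfg (R : EuclideanSpace ℝ (Fin d) ≃L[ℝ] EuclideanSpace ℝ (Fin d))
    (w : Fin n → ℂ) (y : Fin n → EuclideanSpace ℝ (Fin d)) (k : Fin n) :
    lorentzActC (spatialRotation R) (tsCfg w y k) = tsCfg w (fun j => R (y j)) k := by
  have hre : rePart (tsCfg w y k) = ofTimeSpace (w k).re (y k) := by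
    ext μ; refine Fin.cases ?_ (fun i => ?_) μ <;> simp [rePart_apply]
  have him : imPart (tsCfg w y k) = ofTimeSpace (w k).im 0 := by
    ext μ; refine Fin.cases ?_ (fun i => ?_) μ <;> simp [imPart_apply]
  rw [lorentzActC, hre, him]
  funext μ
  refine Fin.cases ?_ (fun i => ?_) μ
  · simp only [Pi.add_apply, complexifyPoint_apply, spatialRotation_apply, timeC_apply,
      ofTimeSpace_apply_zero, Pi.smul_apply, smul_eq_mul, tsCfg_apply_zero]
    rw [mul_comm]
    exact re_add_im (w k)
  · simp only [Pi.add_apply, complexifyPoint_apply, spatialRotation_apply, timeC_apply,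
      spaceC_ofTimeSpace, ofTimeSpace_apply_succ, map_zero, Pi.smul_apply, smul_eq_mul,
      tsCfg_apply_succ, PiLp.zero_apply, ofReal_zero, mul_zero, add_zero]

/-- The diagonal complexified action of a spatial isometry on `tsCfg w y`. [folklore] -/
theorem lorentzActC_spatialRotation_tsCfg_diag (R : EuclideanSpace ℝ (Fin d) ≃L[ℝ] EuclideanSpace ℝ (Fin d))
    (w : Fin n → ℂ) (y : Fin n → EuclideanSpace ℝ (Fin d)) :
    (fun k => lorentzActC (spatialRotation R) (tsCfg w y k)) = tsCfg w fun j => R (y j) :=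
  funext fun k => lorentzActC_spatialRotation_tsCfg R w y k

/-- Spatial isometries preserve the time tube. [folklore] -/
theorem lorentzActC_spatialRotation_mem_timeTube (R : EuclideanSpace ℝ (Fin d) ≃L[ℝ] EuclideanSpace ℝ (Fin d))
    {z : Fin n → Fin (d + 1) → ℂ} (hz : z ∈ timeTube d n) :
    (fun k => lorentzActC (spatialRotation R) (z k)) ∈ timeTube d n := by
  rw [← tsCfg_timesOf_spaceOf hz.1, lorentzActC_spatialRotation_tsCfg_diag, tsCfg_mem_timeTube_iff]
  exact timesOf_mem_cTimeTube hz

/-- Spatial isometries of Euclidean configurations preserve time-ordering. [folklore] -/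
theorem spatialIsometry_diag_mem_timeOrderedRegion_iff
    (R : EuclideanSpace ℝ (Fin d) ≃ₗᵢ[ℝ] EuclideanSpace ℝ (Fin d))
    (x : Fin n → EuclideanSpace ℝ (Fin (d + 1))) :
    (fun k => spatialIsometry R (x k)) ∈ timeOrderedRegion d n ↔ x ∈ timeOrderedRegion d n := by
  simp only [timeOrderedRegion, mem_setOf_eq, spatialIsometry_apply_zero]

variable {S : SchwingerFamily (EuclideanSpace ℝ (Fin (d + 1)))}
  {𝔚 : (Fin n → Fin (d + 1) → ℂ) → ℂ} {T : 𝓢((Fin n → SpaceTime d), ℂ) →L[ℂ] ℂ}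

/-- The Euclidean restriction of a continuous function on the time tube is continuous on the
time-ordered region. [folklore] -/
theorem _root_.ContinuousOn.euclideanPoint_of_timeTube {E : Type*} [TopologicalSpace E]
    {𝔚 : (Fin n → Fin (d + 1) → ℂ) → E} (hc : ContinuousOn 𝔚 (timeTube d n)) :
    ContinuousOn (fun x => 𝔚 (euclideanPoint x)) (timeOrderedRegion d n) :=
  hc.comp continuous_euclideanPoint.continuousOn fun _ hx => euclideanPoint_mem_timeTube hx

/-! ### E1: spatial isometries act trivially on the time tube -/

/-- **Spatial isometries act trivially on an OS time continuation** (E1 at Euclidean points and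
the identity theorem for time-holomorphic functions): if `𝔖ₙ` is Euclidean covariant and `𝔚` is
continuous on the time tube, holomorphic in the times, with Euclidean restriction `𝔖ₙ` on
time-ordered test functions, then `𝔚 ((1 ⊕ R)_ℂ z) = 𝔚 z` on the time tube for every linear
isometry `R` of space. [cite: OsterwalderSchraderCMP1973, §4.2] -/
theorem apply_lorentzActC_spatialRotation_eq (hE1 : S.IsEuclideanCovariant)
    (hc : ContinuousOn 𝔚 (timeTube d n)) (hh : IsTimeHolomorphicOn 𝔚 (timeTube d n))
    (hS : ∀ F : 𝓢((Fin n → EuclideanSpace ℝ (Fin (d + 1))), ℂ), IsTimeOrdered F →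
      S n F = ∫ x, 𝔚 (euclideanPoint x) * F x)
    (R : EuclideanSpace ℝ (Fin d) ≃ₗᵢ[ℝ] EuclideanSpace ℝ (Fin d))
    {z : Fin n → Fin (d + 1) → ℂ} (hz : z ∈ timeTube d n) :
    𝔚 (fun k => lorentzActC (spatialRotation R.toContinuousLinearEquiv) (z k)) = 𝔚 z := by
  set Λ := spatialRotation R.toContinuousLinearEquiv with hΛ
  -- the rotated function is again time-holomorphic on the time tube
  have hhR : IsTimeHolomorphicOn (fun z => 𝔚 fun k => lorentzActC Λ (z k)) (timeTube d n) := by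
    intro z hz
    have hset : {w : Fin n → ℂ | withTimes z w ∈ timeTube d n} = cTimeTube n := by
      ext w
      rw [mem_setOf_eq, withTimes_eq_tsCfg hz.1, tsCfg_mem_timeTube_iff]
    have hfun : (fun w => 𝔚 fun k => lorentzActC Λ (withTimes z w k)) =
        fun w => 𝔚 (tsCfg w fun j => R (spaceOf z j)) := by
      funext w
      rw [withTimes_eq_tsCfg hz.1, hΛ, lorentzActC_spatialRotation_tsCfg_diag]
      rfl
    show DifferentiableOn ℂ (fun w => 𝔚 fun k => lorentzActC Λ (withTimes z w k)) _
    rw [hset, hfun]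
    exact hh.differentiableOn_tsCfg _
  refine eqOn_timeTube_of_euclidean hhR hh (fun x hx => ?_) hz
  -- at Euclidean points: E1
  have hcont : ContinuousOn (fun x => 𝔚 (euclideanPoint x)) (timeOrderedRegion d n) :=
    hc.euclideanPoint_of_timeTube
  have hcontR : ContinuousOn (fun x : Fin n → EuclideanSpace ℝ (Fin (d + 1)) =>
      𝔚 fun k => lorentzActC Λ (euclideanPoint x k)) (timeOrderedRegion d n) := by
    have h1 : (fun x : Fin n → EuclideanSpace ℝ (Fin (d + 1)) =>
        𝔚 fun k => lorentzActC Λ (euclideanPoint x k)) =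
        fun x => 𝔚 (euclideanPoint fun j => spatialIsometry R (x j)) := by
      funext x
      simp only [hΛ, lorentzActC_spatialRotation_euclideanPoint]
    rw [h1]
    have hρc : Continuous fun (x : Fin n → EuclideanSpace ℝ (Fin (d + 1))) (j : Fin n) =>
        spatialIsometry R (x j) :=
      continuous_pi fun j => (spatialIsometry R).continuous.comp (continuous_apply j)
    exact hcont.comp hρc.continuousOn fun x hx =>
      (spatialIsometry_diag_mem_timeOrderedRegion_iff R x).2 hx
  refine eqOn_timeOrderedRegion_of_integral_eq hcontR hcont (fun F hF => ?_) hx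
  -- `∫ 𝔚(Λ ιx) F x = ∫ 𝔚(ι(R̂x)) F x = ∫ 𝔚(ιy) F(R̂⁻¹ y) = 𝔖ₙ(F ∘ R̂⁻¹) = 𝔖ₙ(F)`
  simp only [hΛ, lorentzActC_spatialRotation_euclideanPoint]
  have hmp : MeasurePreserving fun x : Fin n → EuclideanSpace ℝ (Fin (d + 1)) =>
      fun k => spatialIsometry R (x k) :=
    volume_preserving_pi fun _ : Fin n => (spatialIsometry R).measurePreserving
  set e : (Fin n → EuclideanSpace ℝ (Fin (d + 1))) ≃ᵐ (Fin n → EuclideanSpace ℝ (Fin (d + 1))) :=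
    (ContinuousLinearEquiv.piCongrRight fun _ : Fin n =>
      (spatialIsometry R).toContinuousLinearEquiv).toHomeomorph.toMeasurableEquiv with he_def
  have he : MeasurePreserving e := hmp
  have hcv := he.integral_comp'
    (fun y => 𝔚 (euclideanPoint y) * linActMulti (spatialIsometry R) F y)
  have he_apply : ∀ x, e x = fun k => spatialIsometry R (x k) := fun x => rfl
  have hcv' : ∫ x, 𝔚 (euclideanPoint fun k => spatialIsometry R (x k)) * F x =
      ∫ y, 𝔚 (euclideanPoint y) * linActMulti (spatialIsometry R) F y := by
    rw [← hcv]
    congr 1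
    funext x
    rw [he_apply, linActMulti_apply]
    simp only [LinearIsometryEquiv.symm_apply_apply]
  rw [hcv', ← hS _ (hF.linActMulti_spatialIsometry R), hE1.linActMulti, hS F hF]

/-! ### From the time tube to the boundary value -/

/-- **Invariance on the time tube passes to the time-ray boundary value** for a Lorentz
transformation `Λ` fixing the time axis: if `𝔚 ∘ Λ_ℂ = 𝔚` on the time tube and `T` is the
time-ray boundary value of `𝔚`, then `T(F ∘ Λ⁻¹) = T(F)` (witness form). Proof: change of
variables `x = Λ y` (`|det Λ| = 1`) in the approximating integrals along the standard temporal
direction `η₀`, which `Λ` fixes, and `Λ_ℂ (y + itη₀) = Λy + itη₀`. [cite: OsterwalderSchraderCMP1973, §4.2] -/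
theorem _root_.Literature.MathematicalPhysics.QuantumFieldTheory.HasTimeRayBoundaryValue.apply_eq_of_timeTube_invariant
    {Λ : SpaceTime d ≃L[ℝ] SpaceTime d} (hΛ : Λ ∈ lorentzGroup d) (he₀ : Λ (e₀ d) = e₀ d)
    (hinv : ∀ z ∈ timeTube d n, 𝔚 (fun k => lorentzActC Λ (z k)) = 𝔚 z)
    (hT : HasTimeRayBoundaryValue 𝔚 T) {F G : 𝓢((Fin n → SpaceTime d), ℂ)}
    (hG : ∀ x, G x = F fun k => Λ.symm (x k)) : T G = T F := by
  set η₀ : Fin n → SpaceTime d := fun k => (((k : ℕ) : ℝ) + 1) • e₀ d with hη₀_def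
  have hη₀ : η₀ ∈ temporalCone d n := stdDirection_mem_temporalCone
  have hΛη : ∀ k, Λ (η₀ k) = η₀ k := fun k => by
    simp only [hη₀_def, map_smul, he₀]
  refine tendsto_nhds_unique_of_eventuallyEq (hT η₀ hη₀ G) (hT η₀ hη₀ F) ?_
  refine eventually_nhdsWithin_of_forall fun t (ht : 0 < t) => ?_
  have hIt : 0 < ((t : ℂ) * I).im := by simpa using ht
  -- change of variables `x = Λ y`
  set e : (Fin n → SpaceTime d) ≃ᵐ (Fin n → SpaceTime d) :=
    (lorentzDiag n Λ).toHomeomorph.toMeasurableEquiv with he_def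
  have he : MeasurePreserving e := measurePreserving_lorentz_diag (n := n) hΛ
  have hcv := he.integral_comp' (fun x => 𝔚 (fun k => complexifyPoint (x k) +
    ((t : ℂ) * I) • complexifyPoint (η₀ k)) * G x)
  have he_apply : ∀ y, e y = fun k => Λ (y k) := fun y => rfl
  beta_reduce
  rw [← hcv]
  congr 1
  funext y
  rw [he_apply]
  have hray : (fun k => complexifyPoint (Λ (y k)) + ((t : ℂ) * I) • complexifyPoint (η₀ k)) =
      fun k => lorentzActC Λ (complexifyPoint (y k) + ((t : ℂ) * I) • complexifyPoint (η₀ k)) := by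
    funext k
    rw [lorentzActC_ray, hΛη]
  have hmem : (fun k => complexifyPoint (y k) + ((t : ℂ) * I) • complexifyPoint (η₀ k)) ∈
      timeTube d n := rayC_mem_timeTube y hη₀ hIt
  rw [hray, hinv _ hmem, hG]
  congr 2
  funext k
  exact Λ.symm_apply_apply (y k)

/-- Spatial isometries fix the time axis. [folklore] -/
theorem spatialRotation_apply_e₀ (R : EuclideanSpace ℝ (Fin d) ≃L[ℝ] EuclideanSpace ℝ (Fin d)) :
    spatialRotation R (e₀ d) = e₀ d := by
  ext μ
  refine Fin.cases ?_ (fun i => ?_) μ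
  · simp [timeC_apply]
  · have h0 : spaceC d (e₀ d) = 0 := by ext j; simp [Fin.succ_ne_zero]
    simp [h0, Fin.succ_ne_zero]

/-- **Spatial isometries leave the time-ray boundary value invariant** (the `1 ⊕ O(d)` part of
Osterwalder–Schrader I, §4.2, for a function known on the time tube only): under E1, for `𝔚`
continuous on the time tube, holomorphic in the times, with Euclidean restriction `𝔖ₙ` and
time-ray boundary value `T`, `T(F ∘ (1 ⊕ R)⁻¹) = T(F)` for every linear isometry `R` of space. [cite: OsterwalderSchraderCMP1973, §4.2] -/
theorem _root_.Literature.MathematicalPhysics.QuantumFieldTheory.HasTimeRayBoundaryValue.apply_eq_of_spatialRotation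
    (hE1 : S.IsEuclideanCovariant) (hc : ContinuousOn 𝔚 (timeTube d n))
    (hh : IsTimeHolomorphicOn 𝔚 (timeTube d n))
    (hS : ∀ F : 𝓢((Fin n → EuclideanSpace ℝ (Fin (d + 1))), ℂ), IsTimeOrdered F →
      S n F = ∫ x, 𝔚 (euclideanPoint x) * F x)
    (hT : HasTimeRayBoundaryValue 𝔚 T) (R : EuclideanSpace ℝ (Fin d) ≃ₗᵢ[ℝ] EuclideanSpace ℝ (Fin d))
    {F G : 𝓢((Fin n → SpaceTime d), ℂ)}
    (hG : ∀ x, G x = F fun k => (spatialRotation R.toContinuousLinearEquiv).symm (x k)) :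
    T G = T F :=
  hT.apply_eq_of_timeTube_invariant (spatialRotation_mem_lorentzGroup R)
    (spatialRotation_apply_e₀ R.toContinuousLinearEquiv)
    (fun _ hz => apply_lorentzActC_spatialRotation_eq hE1 hc hh hS R hz) hG

end Literature.MathematicalPhysics.QuantumFieldTheory
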